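import Summits.PneNP.PneNP.Theses.RamseyUncertifiable

/-!
# `ResolutionUncertainty` implies `RegularResolutionRung` (ladder order, sorry-free)

Item `stmt-PneNP-9816` (`Summit.PneNP.PneNP.Theses.RamseyUncertifiable.ResolutionUncertainty`), support of route
`RamseyUncertifiable`; helper file (`--supports`), it does NOT close the item.

The two resolution rungs of the route's ladder share, character for character, the unary clique CNF and the
conclusion `n^{ε log₂ n} ≤ max |π₁| |π₂|`; the regular rung (`stmt-PneNP-9818`, the verbatim open question of
Atserias–Bonacina–de Rezende–Lauria–Nordström–Razborov, arXiv:2012.09476 §9) merely adds the hypotheses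
`IsRegular π₁`, `IsRegular π₂`. Hence the dag-like item is formally AT LEAST AS HARD as the regular rung: this
file records the implication `ResolutionUncertainty → RegularResolutionRung` as a kernel-checked edge of the
ladder (tree-like rung: proved, `treeLike_resolutionUncertainty_max`; pin-monotone / careful rungs: proved;
regular rung: open; dag-like item: open, LPRT arXiv:1303.3166 §1.1). It is a NECESSARY condition for the item in
the sense of the route's census: any proof of the item closes `stmt-PneNP-9818` by this glue.
-/

-- the mandated namespace `Summit.PneNP.PneNP.…` (summit = problem = `PneNP`) repeats `PneNP` by design
set_option linter.dupNamespace false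

namespace Summit.PneNP.PneNP.Theorems.RamseyUncertifiableResolutionUncertainty

open Summit.PneNP.PneNP.Theses.RamseyUncertifiable

/-- **Ladder order.** The dag-like resolution uncertainty principle for 2-Ramsey graphs
(`ResolutionUncertainty`, item `stmt-PneNP-9816`) implies its regular-resolution rung
(`RegularResolutionRung`, item `stmt-PneNP-9818`): a regular refutation is in particular a refutation, the
two statements having literally the same CNFs, threshold `k = Nat.clog 2 (n²)` and conclusion. -/
theorem regularResolutionRung_of_resolutionUncertainty : ResolutionUncertainty → RegularResolutionRung := by
  rintro ⟨ε, hε, n₀, hn⟩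
  refine ⟨ε, hε, n₀, ?_⟩
  intro n hn' G inst
  have hG := hn n hn' G
  intro k cnf π₁ π₂ h₁ _ h₂ _
  exact hG π₁ π₂ h₁ h₂

end Summit.PneNP.PneNP.Theorems.RamseyUncertifiableResolutionUncertainty
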